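import Literature.AlgebraicGeometry.Motives.HodgeLieOfAbelianVarietySemisimpleTimesCM
import Literature.AlgebraicGeometry.Motives.HodgeLieSemisimpleTimesAbelianCenter
import Literature.AlgebraicGeometry.Motives.HodgeLieCenterIsomorphismInvariance
import Literature.AlgebraicGeometry.Motives.HodgeLieOfAbelianVarietyPower
import HarnessLib

/-!
# The centre and the semisimple part of `Lie Hg(H¹X)` for complex abelian varieties: isogeny invariance, powers, and
# `X₁ × X₂` with `Hg(X₁)` semisimple and `X₂` of CM type (`dim 𝔷 = dim Lie Hg(H¹X₂)`, `dim [𝔥, 𝔥] = dim Lie Hg(H¹X₁)`)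

Family `hodge`, layer `Literature/AlgebraicGeometry/Motives`; THEOREMS ONLY (no definition, no named fact).  Written for
the cell `pub-hodgecm2` (COR-CM), seat `b27` gen 43 (count-neutral Mumford–Tate-rank ladder).  For the Betti Hodge
structure `H¹(X)` of a complex abelian variety write `𝔥 = Lie Hg(H¹X)` (`hodgeLie`), `𝔷 = 𝔥 ∩ End⁰` (the centre; the
type-IV part) and `𝔡 = span {XY − YX}` (the derived = semisimple part), so that `dim 𝔥 = dim 𝔷 + dim 𝔡` (Deligne I 3.6,
the tree's `finrank_hodgeLie_eq_center_add_derived`).  This file transports the abstract results of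
`Motives/HodgeLieCenterIsomorphismInvariance` (`𝔷`, `𝔡` under conjugation and under the diagonal) and of
`Motives/HodgeLieSemisimpleTimesAbelianCenter` (`𝔷(H₁ ⊕ H₂) = ι₂ 𝔥(H₂) π₂`, `dim 𝔡(H₁ ⊕ H₂) = dim 𝔥(H₁)`) to varieties:

* §1 `finrank_hodgeLie_inf_endAlg_hodge_one_eq_of_isIsogenous`, `finrank_hodgeLie_derived_hodge_one_eq_of_isIsogenous` —
  `dim 𝔷` and `dim 𝔡` are ISOGENY INVARIANTS (`H¹(X') = (g^*)^* H¹(X)`).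
* §2 `finrank_hodgeLie_inf_endAlg_hodge_one_eq_of_isIsogenous_biproduct_const`, `…derived…` — and do not change under
  `B ↦ X ∼ B^{m+1}` (Künneth + the diagonal; Moonen–Zarhin §1 «`Hg(Xⁿ) = Hg(X)` acting diagonally»).
* §3 **`finrank_hodgeLie_inf_endAlg_and_derived_hodge_one_eq_of_bicone`** / **`…_of_isIsogenous_prod`** —
  `dim 𝔷(H¹X) = dim Lie Hg(H¹X₂)` and `dim 𝔡(H¹X) = dim Lie Hg(H¹X₁)` for every `X ∼ X₁ × X₂` with
  `Lie Hg(H¹X₁) ∩ End⁰ = 0` and `Lie Hg(H¹X₂)` commutative (Moonen–Zarhin Thm. (3.2)(2): the centre of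
  `Hg(X₁ × X₂) = Hg(X₁) × Hg(X₂)` is the torus `Hg(X₂)`, its semisimple part is `Hg(X₁)`).

## References
* [MoonenZarhin1999LowDim] B. Moonen, Yu. Zarhin, Math. Ann. 315 (1999), §1, §3 (3.1), Thm. (3.2)(2)
  [corpus: paper:arxiv-math_9901113 pp. 2, 6]. [cite: MoonenZarhin1999LowDim, §3 Thm. (3.2)(2)]
* [Deligne1982HodgeCycles] P. Deligne, LNM 900 (1982), I §3.1, Prop. 3.4, Prop. 3.6. [cite: Deligne1982HodgeCycles, I §3 Prop. 3.6]
* [VoisinHodgeI2002] C. Voisin, *Hodge Theory and Complex Algebraic Geometry I*, §7.3.2, Thm. 11.38. [cite: VoisinHodgeI2002, §7.3.2]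
-/

noncomputable section

open CategoryTheory CategoryTheory.Limits

namespace Literature.AlgebraicGeometry.Motives

namespace AbelianVariety

open Literature.AlgebraicGeometry.HodgeTheory
open Literature.AlgebraicGeometry.Motives.HodgeStructure
open Literature.AlgebraicGeometry.Pohlmann1968 (hodge_one_eq_comapEquiv_of_isIsogeny)
open Literature.AlgebraicGeometry.ComplexMultiplication

variable [HodgeTensorFacts.{0, 0}]

/-! ### §1 Isogeny invariance of `dim 𝔷` and `dim 𝔡` -/

section Isogeny

variable {X X' : AbelianVariety ℂ} {n m : ℕ} (hX : IsSmoothProjective n X.X) (hX' : IsSmoothProjective m X'.X)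

/-- **`dim 𝔷(H¹X) = dim 𝔷(H¹X')` for isogenous complex abelian varieties** (`𝔷 = Lie Hg ∩ End⁰`, the centre of the
Hodge Lie algebra). [cite: MoonenZarhin1999LowDim, §1] [cite: VoisinHodgeI2002, §7.3.2] -/
theorem finrank_hodgeLie_inf_endAlg_hodge_one_eq_of_isIsogenous (h : IsIsogenous X X') :
    haveI := BettiUniverse.finite hX 1
    haveI := BettiUniverse.finite hX' 1
    Module.finrank ℚ ↥((BettiUniverse.hodge exists_isReal_hodgeModel_holds hX 1).hodgeLie ⊓
        Subalgebra.toSubmodule (BettiUniverse.hodge exists_isReal_hodgeModel_holds hX 1).endAlg) =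
      Module.finrank ℚ ↥((BettiUniverse.hodge exists_isReal_hodgeModel_holds hX' 1).hodgeLie ⊓
        Subalgebra.toSubmodule (BettiUniverse.hodge exists_isReal_hodgeModel_holds hX' 1).endAlg) := by
  haveI := BettiUniverse.finite hX 1
  haveI := BettiUniverse.finite hX' 1
  obtain ⟨g, hg⟩ := h
  rw [hodge_one_eq_comapEquiv_of_isIsogeny hX hX' hg]
  exact (finrank_hodgeLie_inf_endAlg_comapEquiv _ _).symm

/-- **`dim [𝔥, 𝔥](H¹X) = dim [𝔥, 𝔥](H¹X')` for isogenous complex abelian varieties** (the semisimple part of the Hodge Lie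
algebra). [cite: MoonenZarhin1999LowDim, §1] [cite: VoisinHodgeI2002, §7.3.2] -/
theorem finrank_hodgeLie_derived_hodge_one_eq_of_isIsogenous (h : IsIsogenous X X') :
    haveI := BettiUniverse.finite hX 1
    haveI := BettiUniverse.finite hX' 1
    Module.finrank ℚ ↥(Submodule.span ℚ {B | ∃ A ∈ (BettiUniverse.hodge exists_isReal_hodgeModel_holds hX 1).hodgeLie,
        ∃ C ∈ (BettiUniverse.hodge exists_isReal_hodgeModel_holds hX 1).hodgeLie, A * C - C * A = B}) =
      Module.finrank ℚ ↥(Submodule.span ℚ {B | ∃ A ∈ (BettiUniverse.hodge exists_isReal_hodgeModel_holds hX' 1).hodgeLie,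
        ∃ C ∈ (BettiUniverse.hodge exists_isReal_hodgeModel_holds hX' 1).hodgeLie, A * C - C * A = B}) := by
  haveI := BettiUniverse.finite hX 1
  haveI := BettiUniverse.finite hX' 1
  obtain ⟨g, hg⟩ := h
  rw [hodge_one_eq_comapEquiv_of_isIsogeny hX hX' hg]
  exact (finrank_hodgeLie_derived_comapEquiv _ _).symm

end Isogeny

/-! ### §2 Powers -/

section Const

variable {B : AbelianVariety ℂ} {k a : ℕ} (hBsp : IsSmoothProjective k B.X)

/-- **`dim 𝔷(H¹X) = dim 𝔷(H¹B)` for every `X ∼ ⨁_{Fin (a+1)} B`** (Künneth in degree one, `𝔷(e^* H) = e⁻¹ 𝔷(H) e`,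
`𝔷(H^{⊕ι}) = Δ 𝔷(H)`). [cite: MoonenZarhin1999LowDim, §1] [cite: VoisinHodgeI2002, §7.3.2] -/
theorem finrank_hodgeLie_inf_endAlg_hodge_one_eq_of_isIsogenous_biproduct_const {X : AbelianVariety ℂ} {n' : ℕ}
    (hX : IsSmoothProjective n' X.X) (h : IsIsogenous X (⨁ fun _ : Fin (a + 1) => B)) :
    haveI := BettiUniverse.finite hX 1
    haveI := BettiUniverse.finite hBsp 1
    Module.finrank ℚ ↥((BettiUniverse.hodge exists_isReal_hodgeModel_holds hX 1).hodgeLie ⊓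
        Subalgebra.toSubmodule (BettiUniverse.hodge exists_isReal_hodgeModel_holds hX 1).endAlg) =
      Module.finrank ℚ ↥((BettiUniverse.hodge exists_isReal_hodgeModel_holds hBsp 1).hodgeLie ⊓
        Subalgebra.toSubmodule (BettiUniverse.hodge exists_isReal_hodgeModel_holds hBsp 1).endAlg) := by
  have hP : IsSmoothProjective (⨁ fun _ : Fin (a + 1) => B).dim (⨁ fun _ : Fin (a + 1) => B).X :=
    AbelianVariety.isSmoothProjective_holds
  haveI := BettiUniverse.finite hX 1
  haveI := BettiUniverse.finite hBsp 1
  haveI := BettiUniverse.finite hP 1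
  rw [finrank_hodgeLie_inf_endAlg_hodge_one_eq_of_isIsogenous hX hP h]
  have hpi := pi_hodge_one_eq_comapEquiv_biproduct (A := fun _ : Fin (a + 1) => B) (fun _ => hBsp) hP
    exists_isReal_hodgeModel_holds hodgePQ_independent_of_hodgeModel_holds
  have heq := finrank_hodgeLie_inf_endAlg_comapEquiv (BettiUniverse.hodge exists_isReal_hodgeModel_holds hP 1)
    (LinearEquiv.ofBijective
      (∑ c, BettiUniverse.pull (biproduct.π (fun _ : Fin (a + 1) => B) c).hom.hom.hom 1 ∘ₗ LinearMap.proj c :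
        (∀ _ : Fin (a + 1), bettiCohomology B.X 1) →ₗ[ℚ] bettiCohomology (⨁ fun _ : Fin (a + 1) => B).X 1)
      (bijective_sum_pull_biproduct_π fun _ : Fin (a + 1) => B))
  rw [← hpi] at heq
  rw [← heq]
  exact finrank_hodgeLie_inf_endAlg_pi_const_eq _

/-- **`dim [𝔥, 𝔥](H¹X) = dim [𝔥, 𝔥](H¹B)` for every `X ∼ ⨁_{Fin (a+1)} B`.** [cite: MoonenZarhin1999LowDim, §1]
[cite: VoisinHodgeI2002, §7.3.2] -/
theorem finrank_hodgeLie_derived_hodge_one_eq_of_isIsogenous_biproduct_const {X : AbelianVariety ℂ} {n' : ℕ}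
    (hX : IsSmoothProjective n' X.X) (h : IsIsogenous X (⨁ fun _ : Fin (a + 1) => B)) :
    haveI := BettiUniverse.finite hX 1
    haveI := BettiUniverse.finite hBsp 1
    Module.finrank ℚ ↥(Submodule.span ℚ {C | ∃ A ∈ (BettiUniverse.hodge exists_isReal_hodgeModel_holds hX 1).hodgeLie,
        ∃ D ∈ (BettiUniverse.hodge exists_isReal_hodgeModel_holds hX 1).hodgeLie, A * D - D * A = C}) =
      Module.finrank ℚ ↥(Submodule.span ℚ {C | ∃ A ∈ (BettiUniverse.hodge exists_isReal_hodgeModel_holds hBsp 1).hodgeLie,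
        ∃ D ∈ (BettiUniverse.hodge exists_isReal_hodgeModel_holds hBsp 1).hodgeLie, A * D - D * A = C}) := by
  have hP : IsSmoothProjective (⨁ fun _ : Fin (a + 1) => B).dim (⨁ fun _ : Fin (a + 1) => B).X :=
    AbelianVariety.isSmoothProjective_holds
  haveI := BettiUniverse.finite hX 1
  haveI := BettiUniverse.finite hBsp 1
  haveI := BettiUniverse.finite hP 1
  rw [finrank_hodgeLie_derived_hodge_one_eq_of_isIsogenous hX hP h]
  have hpi := pi_hodge_one_eq_comapEquiv_biproduct (A := fun _ : Fin (a + 1) => B) (fun _ => hBsp) hP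
    exists_isReal_hodgeModel_holds hodgePQ_independent_of_hodgeModel_holds
  have heq := finrank_hodgeLie_derived_comapEquiv (BettiUniverse.hodge exists_isReal_hodgeModel_holds hP 1)
    (LinearEquiv.ofBijective
      (∑ c, BettiUniverse.pull (biproduct.π (fun _ : Fin (a + 1) => B) c).hom.hom.hom 1 ∘ₗ LinearMap.proj c :
        (∀ _ : Fin (a + 1), bettiCohomology B.X 1) →ₗ[ℚ] bettiCohomology (⨁ fun _ : Fin (a + 1) => B).X 1)
      (bijective_sum_pull_biproduct_π fun _ : Fin (a + 1) => B))
  rw [← hpi] at heq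
  rw [← heq]
  exact finrank_hodgeLie_derived_pi_const_eq _

end Const

/-! ### §3 `X ∼ X₁ × X₂` with `Lie Hg(H¹X₁)` centre-free and `Lie Hg(H¹X₂)` commutative -/

section Main

variable {X X₁ X₂ : AbelianVariety ℂ} {n n₁ n₂ : ℕ} (hX : IsSmoothProjective n X.X) (hX₁ : IsSmoothProjective n₁ X₁.X)
  (hX₂ : IsSmoothProjective n₂ X₂.X)

/-- **For a bicone `X ≅ X₁ × X₂` with `Lie Hg(H¹X₁)` centre-free and `Lie Hg(H¹X₂)` commutative: `dim 𝔷(H¹X) = dim Lie Hg(H¹X₂)`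
and `dim [𝔥, 𝔥](H¹X) = dim Lie Hg(H¹X₁)`** (`HodgeStructure.finrank_hodgeLie_inf_endAlg_eq_of_centerFree_of_abelian`,
`HodgeStructure.finrank_hodgeLie_derived_eq_of_centerFree_of_abelian` for the retracts `p_k^*`, `i_k^*`).
[cite: MoonenZarhin1999LowDim, §3 Thm. (3.2)(2)] [cite: Deligne1982HodgeCycles, I §3 Prop. 3.6] -/
theorem finrank_hodgeLie_inf_endAlg_and_derived_hodge_one_eq_of_bicone (p₁ : X ⟶ X₁) (i₁ : X₁ ⟶ X) (p₂ : X ⟶ X₂)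
    (i₂ : X₂ ⟶ X) (h₁ : i₁ ≫ p₁ = 𝟙 X₁) (h₂ : i₂ ≫ p₂ = 𝟙 X₂) (hsum : p₁ ≫ i₁ + p₂ ≫ i₂ = 𝟙 X)
    (hz₁ : haveI := BettiUniverse.finite hX₁ 1
      (BettiUniverse.hodge exists_isReal_hodgeModel_holds hX₁ 1).hodgeLie ⊓
        Subalgebra.toSubmodule (BettiUniverse.hodge exists_isReal_hodgeModel_holds hX₁ 1).endAlg = ⊥)
    (hab₂ : haveI := BettiUniverse.finite hX₂ 1
      ∀ A ∈ (BettiUniverse.hodge exists_isReal_hodgeModel_holds hX₂ 1).hodgeLie,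
        ∀ B ∈ (BettiUniverse.hodge exists_isReal_hodgeModel_holds hX₂ 1).hodgeLie, A * B = B * A) :
    haveI := BettiUniverse.finite hX 1
    haveI := BettiUniverse.finite hX₁ 1
    haveI := BettiUniverse.finite hX₂ 1
    Module.finrank ℚ ↥((BettiUniverse.hodge exists_isReal_hodgeModel_holds hX 1).hodgeLie ⊓
        Subalgebra.toSubmodule (BettiUniverse.hodge exists_isReal_hodgeModel_holds hX 1).endAlg) =
      Module.finrank ℚ (BettiUniverse.hodge exists_isReal_hodgeModel_holds hX₂ 1).hodgeLie ∧
    Module.finrank ℚ ↥(Submodule.span ℚ {C | ∃ A ∈ (BettiUniverse.hodge exists_isReal_hodgeModel_holds hX 1).hodgeLie,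
        ∃ D ∈ (BettiUniverse.hodge exists_isReal_hodgeModel_holds hX 1).hodgeLie, A * D - D * A = C}) =
      Module.finrank ℚ (BettiUniverse.hodge exists_isReal_hodgeModel_holds hX₁ 1).hodgeLie := by
  haveI := BettiUniverse.finite hX 1
  haveI := BettiUniverse.finite hX₁ 1
  haveI := BettiUniverse.finite hX₂ 1
  obtain ⟨ψ⟩ := BettiUniverse.hodge_isPolarizable exists_isReal_hodgeModel_holds hX 1
  exact ⟨finrank_hodgeLie_inf_endAlg_eq_of_centerFree_of_abelian
    (BettiUniverse.pullHodgeHom exists_isReal_hodgeModel_holds hodgePQ_independent_of_hodgeModel_holds hX hX₁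
      p₁.hom.hom.hom 1)
    (BettiUniverse.pullHodgeHom exists_isReal_hodgeModel_holds hodgePQ_independent_of_hodgeModel_holds hX₁ hX
      i₁.hom.hom.hom 1)
    (BettiUniverse.pullHodgeHom exists_isReal_hodgeModel_holds hodgePQ_independent_of_hodgeModel_holds hX hX₂
      p₂.hom.hom.hom 1)
    (BettiUniverse.pullHodgeHom exists_isReal_hodgeModel_holds hodgePQ_independent_of_hodgeModel_holds hX₂ hX
      i₂.hom.hom.hom 1)
    (fun v => pull_pull_eq_self_of_comp_eq_id h₁ v) (fun v => pull_pull_eq_self_of_comp_eq_id h₂ v)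
    (fun v => pull_pull_add_pull_pull_eq_self p₁ i₁ p₂ i₂ hsum v) ψ hz₁ hab₂,
    finrank_hodgeLie_derived_eq_of_centerFree_of_abelian
    (BettiUniverse.pullHodgeHom exists_isReal_hodgeModel_holds hodgePQ_independent_of_hodgeModel_holds hX hX₁
      p₁.hom.hom.hom 1)
    (BettiUniverse.pullHodgeHom exists_isReal_hodgeModel_holds hodgePQ_independent_of_hodgeModel_holds hX₁ hX
      i₁.hom.hom.hom 1)
    (BettiUniverse.pullHodgeHom exists_isReal_hodgeModel_holds hodgePQ_independent_of_hodgeModel_holds hX hX₂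
      p₂.hom.hom.hom 1)
    (BettiUniverse.pullHodgeHom exists_isReal_hodgeModel_holds hodgePQ_independent_of_hodgeModel_holds hX₂ hX
      i₂.hom.hom.hom 1)
    (fun v => pull_pull_eq_self_of_comp_eq_id h₁ v) (fun v => pull_pull_eq_self_of_comp_eq_id h₂ v)
    (fun v => pull_pull_add_pull_pull_eq_self p₁ i₁ p₂ i₂ hsum v) ψ hz₁ hab₂⟩

/-- **`dim 𝔷(H¹X) = dim Lie Hg(H¹X₂)` and `dim [𝔥, 𝔥](H¹X) = dim Lie Hg(H¹X₁)` for every `X` isogenous to `X₁.prod X₂`** with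
`Lie Hg(H¹X₁)` centre-free and `Lie Hg(H¹X₂)` commutative (the centre of `Hg(X₁ × X₂) = Hg(X₁) × Hg(X₂)` is the torus
`Hg(X₂)`, its semisimple part is `Hg(X₁)`). [cite: MoonenZarhin1999LowDim, §3 Thm. (3.2)(2)]
[cite: Deligne1982HodgeCycles, I §3 Prop. 3.6] -/
theorem finrank_hodgeLie_inf_endAlg_and_derived_hodge_one_eq_of_isIsogenous_prod (h : IsIsogenous X (X₁.prod X₂))
    (hz₁ : haveI := BettiUniverse.finite hX₁ 1
      (BettiUniverse.hodge exists_isReal_hodgeModel_holds hX₁ 1).hodgeLie ⊓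
        Subalgebra.toSubmodule (BettiUniverse.hodge exists_isReal_hodgeModel_holds hX₁ 1).endAlg = ⊥)
    (hab₂ : haveI := BettiUniverse.finite hX₂ 1
      ∀ A ∈ (BettiUniverse.hodge exists_isReal_hodgeModel_holds hX₂ 1).hodgeLie,
        ∀ B ∈ (BettiUniverse.hodge exists_isReal_hodgeModel_holds hX₂ 1).hodgeLie, A * B = B * A) :
    haveI := BettiUniverse.finite hX 1
    haveI := BettiUniverse.finite hX₁ 1
    haveI := BettiUniverse.finite hX₂ 1
    Module.finrank ℚ ↥((BettiUniverse.hodge exists_isReal_hodgeModel_holds hX 1).hodgeLie ⊓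
        Subalgebra.toSubmodule (BettiUniverse.hodge exists_isReal_hodgeModel_holds hX 1).endAlg) =
      Module.finrank ℚ (BettiUniverse.hodge exists_isReal_hodgeModel_holds hX₂ 1).hodgeLie ∧
    Module.finrank ℚ ↥(Submodule.span ℚ {C | ∃ A ∈ (BettiUniverse.hodge exists_isReal_hodgeModel_holds hX 1).hodgeLie,
        ∃ D ∈ (BettiUniverse.hodge exists_isReal_hodgeModel_holds hX 1).hodgeLie, A * D - D * A = C}) =
      Module.finrank ℚ (BettiUniverse.hodge exists_isReal_hodgeModel_holds hX₁ 1).hodgeLie := by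
  have hP : IsSmoothProjective (X₁.prod X₂).dim (X₁.prod X₂).X := AbelianVariety.isSmoothProjective_holds
  rw [finrank_hodgeLie_inf_endAlg_hodge_one_eq_of_isIsogenous hX hP h,
    finrank_hodgeLie_derived_hodge_one_eq_of_isIsogenous hX hP h]
  refine finrank_hodgeLie_inf_endAlg_and_derived_hodge_one_eq_of_bicone hP hX₁ hX₂ (fst X₁ X₂) (prodLift (𝟙 X₁) 0)
    (snd X₁ X₂) (prodLift 0 (𝟙 X₂)) (prodLift_fst _ _) (prodLift_snd _ _) ?_ hz₁ hab₂
  refine prod_hom_ext ?_ ?_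
  · rw [Preadditive.add_comp, Category.assoc, Category.assoc, prodLift_fst, prodLift_fst, Category.comp_id,
      comp_zero, add_zero, Category.id_comp]
  · rw [Preadditive.add_comp, Category.assoc, Category.assoc, prodLift_snd, prodLift_snd, Category.comp_id,
      comp_zero, zero_add, Category.id_comp]

end Main

end AbelianVariety

end Literature.AlgebraicGeometry.Motives

end
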